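import Summits.RiemannHypothesis.RiemannHypothesis.Theorems.GroundBartaEvenWinsBeyondArchDeflationShellGram
import HarnessLib

/-!
# RiemannHypothesis / GroundBarta — rung 4 (`EvenWinsBeyondArch`, stmt-RiemannHypothesis-18807 / 18085):
# the endpoint cell — weighted norms and Gram boxes of the EXTENDED residuals from the standard R-layer data

Helper file (`--supports stmt-RiemannHypothesis-18085`), RH-free, Mathlib + landed tree files only, no definitions, no named
facts.  Prover B (gen 6 of unit `sr-gb-rung-b`).

Corollary of `dt_shell_wgram_bounds` (…ShellGram) in the shape consumed by the per-parity final files of the endpoint cell: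
if the standard R-layer bridge certifies `∫ w‖r_i‖² ≤ sW_i` and `Rlo_ij ≤ ∫ w Re(r_i r̄_j) ≤ Rhi_ij` for the window-`c'`
residuals `r_i = F_i − ΣWv`, then the extended residuals `rx_i = Fx_i − ΣWv` satisfy the same with every bound widened by
`C_w G_i G_j Sh` (`dt_rx_wnorm_le`, `dt_rx_wgram_mem`).
-/

set_option linter.dupNamespace false

noncomputable section

open MeasureTheory Set Filter
open scoped Topology ENNReal NNReal ComplexConjugate BigOperators

namespace Summit.RiemannHypothesis.RiemannHypothesis.Theorems.EvenWinsBeyondArch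

open Literature.NumberTheory.LFunctions

/-- `w‖f‖² = w·Re(f f̄)` pointwise, hence `∫ w‖f‖² = ∫ w Re(f f̄)`. [folklore] -/
theorem dt_integral_wnorm_sq_eq_wpairing (w : ℝ → ℝ) (f : ℝ → ℂ) :
    ∫ y, w y * ‖f y‖ ^ 2 = ∫ y, w y * (f y * conj (f y)).re := by
  refine integral_congr_ae (Eventually.of_forall fun y ↦ ?_)
  simp only [Complex.mul_conj, Complex.ofReal_re, Complex.normSq_eq_norm_sq]

/-- **Weighted norms and Gram boxes of the extended residuals.**  Under the hypotheses of `dt_shell_wgram_bounds`: if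
`∫ w‖F_i − ΣWv‖² ≤ sW_i` and `Rlo_ij ≤ ∫ w Re((F_i − ΣWv)(F_j − ΣWv)^*) ≤ Rhi_ij`, then
`∫ w‖Fx_i − ΣWv‖² ≤ sW_i + C_w G_i² Sh` and `Rlo_ij − C_w G_iG_j Sh ≤ ∫ w Re((Fx_i − ΣWv)(Fx_j − ΣWv)^*) ≤ Rhi_ij + C_w G_iG_j Sh`.
[folklore] -/
theorem dt_rx_wgram_bounds {c' b : ℝ} (hc' : 0 < c') (hcb : c' < b) (hδ1 : b - c' ≤ 1) {k : ℕ}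
    (g : Fin k → ℝ → ℝ) (hg : ∀ i, ContDiff ℝ 2 (g i)) (Gs : Fin k → ℝ)
    (hG : ∀ i, ∀ x ∈ Icc (-c') c', |g i x| ≤ Gs i)
    (v F Fx : Fin k → ℝ → ℂ) (hv : ∀ i x, v i x = (((Icc (-c') c').indicator (g i) x : ℝ) : ℂ))
    (hF : ∀ i y, F i y = (Icc (-c') c').indicator (fun y ↦
        2 * (∫ x, v i x * (Real.cosh (x / 2) : ℂ)) * (Real.cosh (y / 2) : ℂ) -
          2 * (∫ x, v i x * (Real.sinh (x / 2) : ℂ)) * (Real.sinh (y / 2) : ℂ) +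
        (∑ m ∈ weilPrimeIndex c', (((ArithmeticFunction.vonMangoldt m : ℝ) / Real.sqrt m : ℝ) : ℂ) *
          (2 * v i y - v i (y - Real.log m) - v i (y + Real.log m))) +
        ∫ t in Ioi 0, (weilArchDensity t : ℂ) * (2 * v i y - v i (y - t) - v i (y + t))) y -
      (weilMarkovConstant c' : ℂ) * v i y)
    (hFx : ∀ i y, Fx i y = (Icc (-b) b).indicator (fun y ↦
        2 * (∫ x, v i x * (Real.cosh (x / 2) : ℂ)) * (Real.cosh (y / 2) : ℂ) -
          2 * (∫ x, v i x * (Real.sinh (x / 2) : ℂ)) * (Real.sinh (y / 2) : ℂ) +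
        (∑ m ∈ weilPrimeIndex c', (((ArithmeticFunction.vonMangoldt m : ℝ) / Real.sqrt m : ℝ) : ℂ) *
          (2 * v i y - v i (y - Real.log m) - v i (y + Real.log m))) +
        ∫ t in Ioi 0, (weilArchDensity t : ℂ) * (2 * v i y - v i (y - t) - v i (y + t))) y -
      (weilMarkovConstant c' : ℂ) * v i y)
    (W : Fin k → Fin k → ℝ) {w : ℝ → ℝ} (hwm : Measurable w) {Cw : ℝ} (hwC : ∀ y, |w y| ≤ Cw)
    {K Sh : ℝ}
    (hK : 4 * c' * (Real.cosh (c' / 2) * Real.cosh (b / 2) + Real.sinh (c' / 2) * Real.sinh (b / 2)) +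
        2 * (∑ n ∈ weilPrimeIndex c', (ArithmeticFunction.vonMangoldt n : ℝ) / Real.sqrt n) +
        2 * (∫ t in Ici 1, weilArchDensity t) ≤ K)
    (hSh : 4 * (b - c') * (K + 3 / 2 * (-Real.log (b - c'))) ^ 2 + 288 * (b - c') ≤ Sh)
    (sW : Fin k → ℝ) (hsW : ∀ i, ∫ y, w y * ‖(F i - ∑ l, W i l • v l) y‖ ^ 2 ≤ sW i)
    (Rlo Rhi : Fin k → Fin k → ℝ)
    (hR : ∀ i j, i ≠ j →
      Rlo i j ≤ ∫ y, w y * ((F i - ∑ l, W i l • v l) y * conj ((F j - ∑ l, W j l • v l) y)).re ∧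
        ∫ y, w y * ((F i - ∑ l, W i l • v l) y * conj ((F j - ∑ l, W j l • v l) y)).re ≤ Rhi i j) :
    (∀ i, ∫ y, w y * ‖(Fx i - ∑ l, W i l • v l) y‖ ^ 2 ≤ sW i + Cw * Gs i * Gs i * Sh) ∧
    (∀ i j, i ≠ j →
      Rlo i j - Cw * Gs i * Gs j * Sh ≤
          ∫ y, w y * ((Fx i - ∑ l, W i l • v l) y * conj ((Fx j - ∑ l, W j l • v l) y)).re ∧
        ∫ y, w y * ((Fx i - ∑ l, W i l • v l) y * conj ((Fx j - ∑ l, W j l • v l) y)).re ≤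
          Rhi i j + Cw * Gs i * Gs j * Sh) := by
  have hshift := fun i j ↦ dt_shell_wgram_bounds hc' hcb hδ1 g hg Gs hG v F Fx hv hF hFx W hwm hwC hK hSh i j
  constructor
  · intro i
    have h := abs_le.1 (hshift i i)
    rw [dt_integral_wnorm_sq_eq_wpairing]
    have h0 := hsW i
    rw [dt_integral_wnorm_sq_eq_wpairing] at h0
    linarith [h.2]
  · intro i j hij
    have h := abs_le.1 (hshift i j)
    obtain ⟨h1, h2⟩ := hR i j hij
    constructor <;> linarith [h.1, h.2]

end Summit.RiemannHypothesis.RiemannHypothesis.Theorems.EvenWinsBeyondArch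

end
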